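import Summits.Ventures.DiscreteObjects.MOLS.ParityObstructionOrder10
import Mathlib.GroupTheory.Perm.Cycle.Type

/-!
# The Cayley table of a group of order `4k+2` has no orthogonal mate (Hall–Paige corollary, kernel)
Framing: lottery ticket; floor = certified bounds/negative ranges.

Cell pub-namedobj (venture DiscreteObjects), target (M), designs gen 9.  `ParityObstructionOrder10.no_orthogonalMate_mulTable` proved the
statement for groups SUPPLIED with a homomorphism onto the group of order 2.  Here the hypothesis is removed, completing the kernel
version of Keedwell–Dénes, *Latin Squares and their Applications* (2015), Corollary to Thm 2.5.5 (Hall–Paige 1955): **for EVERY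
finite group `G` with `|G| ≡ 2 (mod 4)` the multiplication table `(g, h) ↦ g * h` has no Latin orthogonal mate**
(`no_orthogonalMate_mulTable_of_card_mod_four`).  The index-2 subgroup comes from the regular representation: an element `g` of
order 2 (Cauchy) acts on `G` by left multiplication as a fixed-point-free involution, a product of `|G|/2 = 2k+1` transpositions,
so `sign ∘ (left regular representation) : G →* ℤˣ` takes the value `-1` (`sign_toPerm_eq_neg_one`) and its kernel has index 2;
the `ZMod 2`-grading `g ↦ [sign = -1]` is additive and takes the value `1` exactly `2k+1` times, and the parity obstruction
(`no_orthogonalMate_of_grading`) applies.  For order 10 this covers both groups at once (cf. `cyclicSquare10_no_orthogonalMate`,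
`dihedralSquare10_no_orthogonalMate`).  Replication of print; formalisation ours; no `sorry`.
-/

namespace Summit.Ventures.DiscreteObjects.MOLS

open Finset Literature.Combinatorics.Designs.LatinSquares

section HallPaige

variable {G : Type*} [Group G] [Fintype G] [DecidableEq G]

/-- Left multiplication by an element of order `2` of a group of order `≡ 2 (mod 4)` is an odd permutation. -/
theorem sign_toPerm_eq_neg_one {g : G} (hg : orderOf g = 2) (hcard : Fintype.card G % 4 = 2) :
    Equiv.Perm.sign (MulAction.toPerm g : Equiv.Perm G) = -1 := by
  set τ : Equiv.Perm G := MulAction.toPerm g with hτdef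
  have hτ : orderOf τ = 2 := by
    have h := orderOf_injective (MulAction.toPermHom G G) (MulAction.toPerm_injective (α := G) (β := G)) g
    rw [MulAction.coe_toPermHom] at h
    rw [hτdef, h, hg]
  obtain ⟨m, hm⟩ := Equiv.Perm.cycleType_prime_order (σ := τ) (by rw [hτ]; exact Nat.prime_two)
  rw [hτ] at hm
  have hg1 : g ≠ 1 := by
    intro h; rw [h, orderOf_one] at hg; exact absurd hg (by norm_num)
  have hsupp : τ.support = univ := by
    ext x
    simp only [Equiv.Perm.mem_support, mem_univ, iff_true, hτdef, MulAction.toPerm_apply, smul_eq_mul]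
    intro h
    exact hg1 (mul_eq_right.mp h)
  have hsum := Equiv.Perm.sum_cycleType τ
  rw [hm, Multiset.sum_replicate, hsupp, card_univ, smul_eq_mul] at hsum
  rw [Equiv.Perm.sign_of_cycleType, hm, Multiset.sum_replicate, Multiset.card_replicate, smul_eq_mul]
  have hodd : Odd ((m + 1) * 2 + (m + 1)) := by
    rw [Nat.odd_iff]; omega
  exact hodd.neg_one_pow

/-- A group of order `≡ 2 (mod 4)` has a homomorphism ONTO `ℤˣ` (an index-2 subgroup): the sign of the left regular
representation. -/
theorem exists_hom_units_neg_one (hcard : Fintype.card G % 4 = 2) :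
    ∃ φ : G →* ℤˣ, ∃ g : G, φ g = -1 := by
  haveI : Fact (Nat.Prime 2) := ⟨Nat.prime_two⟩
  obtain ⟨g, hg⟩ := exists_prime_orderOf_dvd_card 2 (show 2 ∣ Fintype.card G by omega)
  refine ⟨Equiv.Perm.sign.comp (MulAction.toPermHom G G), g, ?_⟩
  rw [MonoidHom.comp_apply]
  exact sign_toPerm_eq_neg_one hg hcard

/-- **Keedwell–Dénes 2015, Cor. to Thm 2.5.5 (Hall–Paige 1955), kernel.**  The multiplication table of a finite group of order
`≡ 2 (mod 4)` has no Latin orthogonal mate (equivalently no transversal / the group has no complete mapping). -/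
theorem no_orthogonalMate_mulTable_of_card_mod_four (hcard : Fintype.card G % 4 = 2) {M : G → G → G}
    (hM : IsLatinSquare M) : ¬ IsOrthogonalMate (fun g h : G => g * h) M := by
  obtain ⟨φ, g₀, hg₀⟩ := exists_hom_units_neg_one (G := G) hcard
  -- the grading: 0 on the kernel, 1 on the other coset
  let f : G → ZMod 2 := fun g => if φ g = 1 then 0 else 1
  have hf : ∀ x y, f (x * y) = f x + f y := by
    intro x y
    simp only [f, map_mul]
    rcases Int.units_eq_one_or (φ x) with hx | hx <;> rcases Int.units_eq_one_or (φ y) with hy | hy <;>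
      (simp [hx, hy]; try decide)
  refine no_orthogonalMate_of_grading _ f hf ?_ hM
  -- the value 1 is taken |G|/2 times, an odd number
  have hfib := MonoidHom.card_fiber_eq_of_mem_range φ (x := (-1 : ℤˣ)) (y := 1) ⟨g₀, hg₀⟩ ⟨1, map_one φ⟩
  have hsplit : (univ.filter fun g => φ g = -1).card + (univ.filter fun g => φ g = 1).card = Fintype.card G := by
    rw [← card_union_of_disjoint, ← card_univ]
    · congr 1
      ext g
      simp only [mem_union, mem_filter, mem_univ, true_and, iff_true]
      rcases Int.units_eq_one_or (φ g) with h | h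
      · exact Or.inr h
      · exact Or.inl h
    · rw [disjoint_filter]
      intro g _ h1 h0
      rw [h1] at h0
      exact absurd h0 (by decide)
  have heq : (univ.filter fun g => f g = 1) = univ.filter fun g => φ g = -1 := by
    ext g
    simp only [mem_filter, mem_univ, true_and, f]
    rcases Int.units_eq_one_or (φ g) with h | h
    · simp [h]
    · simp [h, show (-1 : ℤˣ) ≠ 1 by decide]
  rw [heq, Nat.odd_iff]
  omega

end HallPaige

end Summit.Ventures.DiscreteObjects.MOLS
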